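import Summits.ResolutionOfSingularities.ResolutionOfSingularities.Theorems.MarkedTransferCampaignW36Thm614Part1ExactGuardFree
import Literature.AlgebraicGeometry.Hironaka2017.Proofs.S06BaseHike.EquiInvLocOfRegularSing
import Literature.AlgebraicGeometry.Hironaka2017.Proofs.S06BaseHike.Thm6p6b
import HarnessLib

/-!
# [OURS · L1 W3.6 ↔ GAP-LEDGER R20 sub 20b(ii) / R49·T] THE LOCAL EQUI-`Inv` PREMISE H:hEquiCheckLoc, NAMED AT A TYPED CORE FOCUS AND ON A CLASS —
# `CampaignW36.EquiInvLocAt` / `CampaignW36.EquiInvLocOn 𝒞`: «`ξ ↦ Inv_ξ(Ě)` is LOCALLY CONSTANT on `Sing(Ě)_cl`» — and its EXACTNESS BY NAME: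
# at every typed core focus it is EQUIVALENT to ⟨SingRegular(Ě)⟩ (SEAT 2's p506263 ⇒, res-type-090's p506310 ⇐), hence on EVERY class `𝒞`
# `EquiInvLocOn 𝒞 ⟺ Thm614Part1On 𝒞` (20a, p501108) with NO door and NO side condition, and on every class carrying the W3.6 door
# `EquiInvLocOn 𝒞 ⟺ CoreFocusSingRegularOn 𝒞 ⟺ HatClosureRegularOn 𝒞` (p498576) — ONE root for 20a ∧ 20b(ii)-loc, counted once

Cell `res-hironaka`, rung L (rescue), row L-G3, slot W3.6 ↔ GAP-LEDGER R20 (sub-entries 20a / 20b(ii)) and R49·T (résumé residual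
H:hEquiCheckLoc). Typed by the OURS typer o4 (statement-only lane). HOST (custody, no new route): `--supports stmt-ResolutionOfSingularities-16155
--as helper`. Sibling of p506474 `…W36Thm614Part1ExactOnClass` / p508013 `…W36Thm614Part1ExactGuardFree` (20a exact by name on the class).

WHY (records on the cell's STATUS.md). res-adj-3 GAP-AMEND R20 (2/2) 2026-08-27T05:15:49Z (D) re-attributed the premise of 20b(ii) (Eq. (125) p.78
«independent of ξ for E = Ě») to the instance-level equi-`Inv` clause, and NOTE (2/2)′ 05:16:38Z read 20a / 20b(ii) / the R49·T résumé binder as ONE ROOT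
(regularity of `Σ̄_max(Ê) = Sing(Ě)`); k3 settled the LOCAL form H:hEquiCheckLoc «every closed `ξ ∈ Sing(Ě)` has an open `U ∋ ξ` on which
`Inv_η(Ě) = Inv_ξ(Ě)` for all closed `η ∈ Sing(Ě) ∩ U`» as the hinge (p501944 / p502750: «inline, instance-wise; not a typed decl — to be named»). Both
directions of its exactness are now KERNELS at the instance: SEAT 2 (res-D-pv-027 AS res-L1-s36-pv-4) **p506263**
`S06BaseHike.isRegular_sing_of_inv_locallyConst'` (`Inv` locally constant on a certified family over `Sing(Ě)_cl` ⇒ `Sing(Ě)` regular, binder-free) and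
res-type-090 k4 PART 2 **p506310** `S06BaseHike.exists_opens_forall_inv_eq_of_isCoreFocus_of_isRegular` (⟨SingRegular(Ě)⟩ ⇒ `Inv_ξ(Ě)` read off ANY Def. 4.9
datum is locally constant on `Sing(Ě)_cl`; res-adj-3's pre-declared trigger (b)). This file NAMES the premise (instance / class / `p`-slice; p506310 §2's
shape verbatim) and composes the two kernels with the class algebra of p498576 / p501108 / p506474 / p508013 — kernel plumbing, no new mathematics:
* §1 OURS definitions `CampaignW36.EquiInvLocAt IsEdgeData' A n Ě` (instance), `CampaignW36.EquiInvLocOn 𝒞 IsEdgeData IsEdgeData' A n` (class; the binders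
  of `Thm614Part1On`), `equiInvLocOn_mono`.
* §2 per instance (any reading `inv`, `0 < b̂`): `equiInvLocAt_of_isRegular_sing` (p506310), `isRegular_sing_of_equiInvLocAt` (p506263; the certified family
  is CHOSEN by `S16Proof.exists_isEdgeData_ambient` under the embedding-dimension guard `hμ`), `equiInvLocAt_iff_isRegular_sing`; the `_inst` form at
  `IsCoreFocus_inst Ê Ě ed`, where `hμ` is READ OFF the member's own family `ed` through (43).2 and `Ě` is standard by `isStandard_of_isCoreFocus_baseHike`.
* §3 on the class: `equiInvLocOn_of_hatClosureRegularOn` / `_of_coreFocusSingRegularOn`, `isRegular_sing_of_equiInvLocOn`, `hatClosureRegularOn_of_equiInvLocOn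
  (hex)`, **`equiInvLocOn_iff_thm614Part1On`** (EVERY `𝒞`, no door, no side condition), `equiInvLocOn_iff_hatClosureRegularOn (hex)` /
  `_iff_coreFocusSingRegularOn (hex)`, `equiInvLocOn_regularClosureClass`, DNF-half carrier `not_equiInvLocOn_of_singular_member`.
* §4 binder-free `p`-slices: `CampaignW36EquiInvLocOnI 𝒞 p`; **`campaignW36EquiInvLocOnI_iff_thm614Part1OnI 𝒞 p`** (unconditional, every `𝒞`, both readings
  of 20a's produced data), `…_iff_of_door`, `…_iff_of_le_lciOrMonomial 𝒞 p (hlm)`, `…_regularClosure_holds p`, `not_campaignW36EquiInvLocOnI_of_singular_member`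
  / `_of_singular_closure` / `_lciClass_of_singular_closure` (SEAT 1's shape).
NET FOR THE WORD (res-adj-3's to say): on EVERY class `𝒞` and every prime `p`, 20b(ii)-loc|`𝒞` ⟺ 20a|`𝒞` BY NAME; on every sub-class of the door's class
`LCIOrMonomialClass` both ⟺ «`Ě` exists with regular `Sing(Ě)`» ⟺ ⟨HatClosureRegular⟩ — one root, counted once; ✓ on `RegularClosureClass`.

HONEST FRAMING. Every declaration below is an OURS predicate or kernel plumbing over OUR typed class Props and the D-lane's kernels; NOTHING here is a
statement of H. Hironaka's manuscript (2017-03-23, [Hironaka2017], lit key `paper:url-3343fd9e678b`), which stays «under review»; nothing asserts that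
Eq. (125) p.78 or Th. 6.14 (1) p.34 holds or fails as printed — `Thm6_14_1` (row 040a's typed CANDIDATE) enters only inside the HYPOTHESIS-shape class
predicate `Thm614Part1On`. VACUITY: `EquiInvLocAt` is NOT trivially true (it fails wherever `Inv` jumps along `Sing(Ě)_cl`, e.g. SEAT 1's pre-declared cross,
`t = 1` at the node, `2` on the branches — res-adj-3 k2) and NOT trivially false (§2: it holds at every typed core focus with regular `Sing(Ě)`);
`EquiInvLocOn 𝒞` is vacuous exactly on members without a typed core focus, like `Thm614Part1On 𝒞` — hence the door `hex` in the ⟺ with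
`CoreFocusSingRegularOn`. AI typing, weaker than expert review.
Reference (context only, not a premise): H. Hironaka, ms. 2017-03-23, Eq. (34) p.24; Eq. (43) p.30; Th. 6.14 (1) p.34; Eq. (125) p.78. [Hironaka2017]
-/

noncomputable section

set_option linter.dupNamespace false -- mandated namespace of this single-conjunct summit

open _root_.AlgebraicGeometry _root_.TopologicalSpace
namespace Summit.ResolutionOfSingularities.ResolutionOfSingularities.Theorems

open Literature.AlgebraicGeometry.Resolution Literature.AlgebraicGeometry.Hironaka2017
open Literature.AlgebraicGeometry.Hironaka2017.S02Preliminaries Literature.AlgebraicGeometry.Hironaka2017.S04CharAlgebra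
open Literature.AlgebraicGeometry.Hironaka2017.S06BaseHike Literature.AlgebraicGeometry.Hironaka2017.Datum
open Scheme.IdealSheafData IsLocalRing

universe u

namespace CampaignW36

/-! ## §1 The premise, named: at a typed core focus and on a class -/
section Defs

variable (𝒞 : ∀ ⦃W : Scheme.{u}⦄, IdealExponent W → Set W → Prop)
  (IsEdgeData IsEdgeData' : ∀ ⦃X : Scheme.{u}⦄ ⦃p n : ℕ⦄ (E : IdealExponent X) (ξ : X), EdgeDatumAt p n E ξ → Prop)

/-- **[OURS · L1 W3.6 ↔ R20 20b(ii) / R49·T] `CampaignW36.EquiInvLocAt IsEdgeData' A n Ě` — «`ξ ↦ Inv_ξ(Ě)` IS LOCALLY CONSTANT ON `Sing(Ě)_cl`»,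
the LOCAL EQUI-`Inv` PREMISE H:hEquiCheckLoc AT ONE IDEAL EXPONENT, in data-read form**: replaces the role of Eq. (125) p.78 l.33–37 «… at each point
`ξ ∈ Sing(Ě)_cl`, which is independent of `ξ` for `E = Ě`» (and of Def. 15.1 p.75 l.35–36) as CONSUMED by the typed §15/§16 résumé (binder
H:hEquiCheckLoc of p501944 / p502750 / p504681, «inline, instance-wise; not a typed decl»); NOT a statement of the manuscript. For an ideal exponent `Ě` on
the ambient scheme: every closed `ξ ∈ Sing(Ě)` has an open `U ∋ ξ` such that for every closed `η ∈ U ∩ Sing(Ě)` and all Def. 4.9 data `D_η` of `Ě` at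
`η` and `D_ξ` at `ξ` in the provenance `IsEdgeData'`, `inv D_η = inv D_ξ` (row 007's `S04CharAlgebra.inv`; the conclusion shape of p506310
`S06BaseHike.exists_opens_forall_inv_eq_of_isCoreFocus_of_isRegular` verbatim, closedness written `∈ closedPoints`); it quantifies over ALL certified data at
`ξ` AND at `η` — no choice of datum is smuggled and no well-definedness premise is consumed. At a typed core focus it is EQUIVALENT to ⟨SingRegular(Ě)⟩ (§2):
a HYPOTHESIS at the instance, CANDIDATE in general, refutable by one `Ě` whose `Inv` jumps along `Sing(Ě)_cl`. [folklore] -/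
def EquiInvLocAt {p : ℕ} [Fact p.Prime] {K : Type u} [Field K] [CharP K p] (A : AmbientDatum p K) (n : ℕ) (Echeck : IdealExponent A.Z) :
    Prop :=
  ∀ ξ ∈ Echeck.sing, ξ ∈ S02Preliminaries.closedPoints A.Z → ∃ U : A.Z.Opens, ξ ∈ U ∧
    ∀ η ∈ U, η ∈ S02Preliminaries.closedPoints A.Z → η ∈ Echeck.sing →
      ∀ Dη : EdgeDatumAt p n Echeck η, IsEdgeData' Echeck η Dη → ∀ Dξ : EdgeDatumAt p n Echeck ξ, IsEdgeData' Echeck ξ Dξ →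
        S04CharAlgebra.inv Dη = S04CharAlgebra.inv Dξ

/-- **[OURS · L1 W3.6 ↔ R20 20b(ii)] `CampaignW36.EquiInvLocOn 𝒞 IsEdgeData IsEdgeData' A n` — «ON THE CLASS `𝒞`, AT EVERY TYPED CORE FOCUS `Ě`, `Inv_·(Ě)` IS
LOCALLY CONSTANT ON `Sing(Ě)_cl`»**: replaces the role of Eq. (125) p.78 l.33–37 («independent of `ξ` for `E = Ě`») restricted to the class, as the typed
résumé consumes it; NOT a statement of the manuscript. Binders = those of `Thm614Part1On 𝒞` (p501108): for every standard `E` on `A.Z` with `0 < Ê.b`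
(`Ê = baseHike E`), every family `ed` of edge data of `Ê` on `Sing(Ê)_cl` certified in `IsEdgeData`, IF `𝒞 Ê Σ_max`
(`Σ_max = invmaxStratum (Sing(Ê)_cl) (invField Ê ed)`) THEN for EVERY `Ě` with `IsCoreFocus_inst Ê Ě ed` (row 010d), `EquiInvLocAt IsEdgeData' A n Ě`. A
HYPOTHESIS row over the class (refutable by one member with one typed core focus whose `Inv` jumps), never a modulus of record; vacuous on members with no
typed core focus (like `Thm614Part1On`); EQUIVALENT to `Thm614Part1On 𝒞` on every class (§3) and to `CoreFocusSingRegularOn 𝒞` given the door. [folklore] -/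
def EquiInvLocOn {p : ℕ} [Fact p.Prime] {K : Type u} [Field K] [CharP K p] [PerfectField K] (A : AmbientDatum p K) (n : ℕ) : Prop :=
  ∀ (E : IdealExponent A.Z) (ed : EdgeDataOn p n (baseHike E)), E.IsStandard → 0 < (baseHike E).b →
    IsEdgeDataOn IsEdgeData (baseHike E) ed →
    𝒞 (baseHike E) (invmaxStratum ((baseHike E).sing ∩ S02Preliminaries.closedPoints A.Z) (invField (baseHike E) ed)) →
      ∀ Echeck : IdealExponent A.Z, IsCoreFocus_inst (baseHike E) Echeck ed → EquiInvLocAt IsEdgeData' A n Echeck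

variable {𝒞 IsEdgeData IsEdgeData'}

/-- Antitonicity in the class. [folklore] -/
theorem equiInvLocOn_mono {𝒟 : ∀ ⦃W : Scheme.{u}⦄, IdealExponent W → Set W → Prop}
    (hle : ∀ ⦃W⦄ (F : IdealExponent W) (S : Set W), 𝒞 F S → 𝒟 F S) {p : ℕ} [Fact p.Prime] {K : Type u} [Field K] [CharP K p]
    [PerfectField K] {A : AmbientDatum p K} {n : ℕ} (h : EquiInvLocOn 𝒟 IsEdgeData IsEdgeData' A n) :
    EquiInvLocOn 𝒞 IsEdgeData IsEdgeData' A n :=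
  fun E ed hE hb hed hC => h E ed hE hb hed (hle _ _ hC)

end Defs

/-! ## §2 Per instance: the premise is EXACT to ⟨SingRegular(Ě)⟩ at every typed core focus -/
section PerInstance

variable {IsEdgeData' : ∀ ⦃X : Scheme.{u}⦄ ⦃p n : ℕ⦄ (E : IdealExponent X) (ξ : X), EdgeDatumAt p n E ξ → Prop}
  {p : ℕ} [Fact p.Prime] {K : Type u} [Field K] [CharP K p] {n : ℕ}

/-- **⟨SingRegular(Ě)⟩ ⇒ `EquiInvLocAt`** at a typed core focus `Ě` of `Ê` (ANY reading `inv`, `0 < Ê.b`), for every read-provenance implying R1 (`hR1`):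
res-type-090's p506310 `exists_opens_forall_inv_eq_of_isCoreFocus_of_isRegular` by name. Kernel plumbing; NOT a statement of the manuscript. [folklore] -/
theorem equiInvLocAt_of_isRegular_sing (A : AmbientDatum p K) (inv : IdealExponent A.Z → A.Z → EdgeInv n) (Ehat : IdealExponent A.Z)
    (hd : 0 < Ehat.b) {Echeck : IdealExponent A.Z} (h : IsCoreFocus S04CharAlgebra.pAlg inv Ehat Echeck)
    (hR1 : ∀ (η : A.Z) (D : EdgeDatumAt p n Echeck η), IsEdgeData' Echeck η D → S04CharAlgebra.IsEdgeData D)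
    (hreg : Scheme.IsRegular (vanishingIdeal (⟨Echeck.sing, A.isClosed_sing Echeck⟩ : Closeds A.Z)).subscheme) :
    EquiInvLocAt IsEdgeData' A n Echeck := by
  intro ξ hξ hξcl
  obtain ⟨U, hξU, hU⟩ := exists_opens_forall_inv_eq_of_isCoreFocus_of_isRegular A inv Ehat hd h hreg hξ hξcl
  exact ⟨U, hξU, fun η hηU hηcl hη Dη hDη Dξ hDξ => hU η hηU hηcl hη Dη (hR1 η Dη hDη) Dξ (hR1 ξ Dξ hDξ)⟩

/-- **`EquiInvLocAt` ⇒ ⟨SingRegular(Ě)⟩** at a typed core focus `Ě` of `Ê` (ANY reading `inv`, `0 < Ê.b`) over a perfect field, with `Ě` standard and `n` the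
embedding dimension on `Sing(Ě)_cl` (`hμ` — the pointwise guard `μ(max 𝒪_ξ) = n`, NOT the I:`dim Z = n` binder `hn` that p506310's `invOfChoiceBot` form
carries; on class members it is read off `ed`, below), for every read-provenance admitting R1 (`hex'`) with degree-one spanning (`hspan`): a certified family is
CHOSEN (`S16Proof.exists_isEdgeData_ambient`) and SEAT 2's p506263 `isRegular_sing_of_inv_locallyConst'` applies. Kernel plumbing; NOT a statement of the
manuscript. [folklore] -/
theorem isRegular_sing_of_equiInvLocAt [PerfectField K] (A : AmbientDatum p K) (inv : IdealExponent A.Z → A.Z → EdgeInv n)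
    (Ehat : IdealExponent A.Z) (hd : 0 < Ehat.b) {Echeck : IdealExponent A.Z} (h : IsCoreFocus S04CharAlgebra.pAlg inv Ehat Echeck)
    (hstd : Echeck.IsStandard)
    (hμ : ∀ ξ ∈ Echeck.sing ∩ S02Preliminaries.closedPoints A.Z, (maximalIdeal (A.Z.presheaf.stalk ξ)).spanFinrank = n)
    (hex' : ∀ (η : A.Z) (D : EdgeDatumAt p n Echeck η), S04CharAlgebra.IsEdgeData D → IsEdgeData' Echeck η D)
    (hspan : ∀ (η : A.Z) (D : EdgeDatumAt p n Echeck η), IsEdgeData' Echeck η D →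
      ∀ b ∈ stalkIdeal (pAlg Echeck 1) η, b ∈ maximalIdeal (A.Z.presheaf.stalk η) →
        ∃ c : Fin D.r → A.Z.presheaf.stalk η, (∀ j, D.expo j ≠ 0 → c j = 0) ∧
          b - ∑ j, c j * D.g j ∈ maximalIdeal (A.Z.presheaf.stalk η) ^ 2)
    (hE : EquiInvLocAt IsEdgeData' A n Echeck) :
    Scheme.IsRegular (vanishingIdeal (⟨Echeck.sing, A.isClosed_sing Echeck⟩ : Closeds A.Z)).subscheme := by
  have hdat : ∀ (ξ : A.Z) (hξ : ξ ∈ Echeck.sing) (hξcl : ξ ∈ S02Preliminaries.closedPoints A.Z),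
      ∃ D : EdgeDatumAt p n Echeck ξ, S04CharAlgebra.IsEdgeData D := fun ξ hξ hξcl =>
    S16Proof.exists_isEdgeData_ambient A Echeck hstd ξ hξ hξcl (hμ ξ ⟨hξ, hξcl⟩)
  choose Dat hDat using hdat
  refine isRegular_sing_of_inv_locallyConst' A n inv Ehat hd h Dat
    (fun ξ hξ hξcl => hspan ξ (Dat ξ hξ hξcl) (hex' ξ _ (hDat ξ hξ hξcl))) fun P hP hPcl => ?_
  obtain ⟨U, hPU, hU⟩ := hE P hP hPcl
  exact ⟨U, hPU, fun η hηU hηcl hη =>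
    hU η hηU hηcl hη (Dat η hη hηcl) (hex' η _ (hDat η hη hηcl)) (Dat P hP hPcl) (hex' P _ (hDat P hP hPcl))⟩

/-- **`EquiInvLocAt` IS EXACT TO ⟨SingRegular(Ě)⟩ at a typed core focus** (perfect `K`; `Ě` standard; `n` the embedding dimension on `Sing(Ě)_cl`; provenance
`IsEdgeData'` sandwiched between R1 and degree-one spanning — e.g. R1 itself). Kernel plumbing; NOT a statement of the manuscript. [folklore] -/
theorem equiInvLocAt_iff_isRegular_sing [PerfectField K] (A : AmbientDatum p K) (inv : IdealExponent A.Z → A.Z → EdgeInv n)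
    (Ehat : IdealExponent A.Z) (hd : 0 < Ehat.b) {Echeck : IdealExponent A.Z} (h : IsCoreFocus S04CharAlgebra.pAlg inv Ehat Echeck)
    (hstd : Echeck.IsStandard)
    (hμ : ∀ ξ ∈ Echeck.sing ∩ S02Preliminaries.closedPoints A.Z, (maximalIdeal (A.Z.presheaf.stalk ξ)).spanFinrank = n)
    (hR1 : ∀ (η : A.Z) (D : EdgeDatumAt p n Echeck η), IsEdgeData' Echeck η D → S04CharAlgebra.IsEdgeData D)
    (hex' : ∀ (η : A.Z) (D : EdgeDatumAt p n Echeck η), S04CharAlgebra.IsEdgeData D → IsEdgeData' Echeck η D) :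
    EquiInvLocAt IsEdgeData' A n Echeck ↔
      Scheme.IsRegular (vanishingIdeal (⟨Echeck.sing, A.isClosed_sing Echeck⟩ : Closeds A.Z)).subscheme :=
  ⟨isRegular_sing_of_equiInvLocAt A inv Ehat hd h hstd hμ hex' fun η D hD => D.degOneSpan_of_isEdgeData (hR1 η D hD),
    equiInvLocAt_of_isRegular_sing A inv Ehat hd h hR1⟩

/-- **(43).2 carries the embedding-dimension guard**: at a typed core focus `Ě` of `Ê` (any reading `inv`), a family `ed` of Def. 4.9 data of `Ê` on
`Sing(Ê)_cl` gives `μ(max 𝒪_{Z,ξ}) = n` at every closed `ξ ∈ Sing(Ě) ⊆ Sing(Ê)` (`EdgeDatum.spanFinrank_eq`). Kernel plumbing; not a manuscript statement. [folklore] -/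
theorem spanFinrank_maximalIdeal_eq_of_isCoreFocus (A : AmbientDatum p K) (inv : IdealExponent A.Z → A.Z → EdgeInv n)
    (Ehat : IdealExponent A.Z) (ed : EdgeDataOn p n Ehat) {Echeck : IdealExponent A.Z} (h : IsCoreFocus S04CharAlgebra.pAlg inv Ehat Echeck)
    {ξ : A.Z} (hξ : ξ ∈ Echeck.sing ∩ S02Preliminaries.closedPoints A.Z) : (maximalIdeal (A.Z.presheaf.stalk ξ)).spanFinrank = n := by
  have hξ' : ξ ∈ Ehat.sing ∩ S02Preliminaries.closedPoints A.Z := by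
    rw [h.eq43.2] at hξ
    exact ⟨hξ.1.1, hξ.1.2⟩
  exact (ed ξ hξ').spanFinrank_eq

/-- **`_inst` form of the exactness, ALL GUARDS READ OFF THE MEMBER**: for `E` standard with `0 < Ê.b` over a perfect field, a family `ed` of edge data of `Ê`,
and `Ě` with `IsCoreFocus_inst Ê Ě ed` (row 010d): `EquiInvLocAt IsEdgeData' A n Ě ↔ Sing(Ě) regular` (`Ě` standard by `isStandard_of_isCoreFocus_baseHike`,
`μ = n` by `spanFinrank_maximalIdeal_eq_of_isCoreFocus`). Kernel plumbing; NOT a statement of the manuscript. [folklore] -/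
theorem equiInvLocAt_iff_isRegular_sing_of_isCoreFocus_inst [PerfectField K] (A : AmbientDatum p K) (E : IdealExponent A.Z)
    (hE : E.IsStandard) (hb : 0 < (baseHike E).b) (ed : EdgeDataOn p n (baseHike E)) {Echeck : IdealExponent A.Z}
    (hEc : IsCoreFocus_inst (baseHike E) Echeck ed)
    (hR1 : ∀ (η : A.Z) (D : EdgeDatumAt p n Echeck η), IsEdgeData' Echeck η D → S04CharAlgebra.IsEdgeData D)
    (hex' : ∀ (η : A.Z) (D : EdgeDatumAt p n Echeck η), S04CharAlgebra.IsEdgeData D → IsEdgeData' Echeck η D) :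
    EquiInvLocAt IsEdgeData' A n Echeck ↔
      Scheme.IsRegular (vanishingIdeal (⟨Echeck.sing, A.isClosed_sing Echeck⟩ : Closeds A.Z)).subscheme :=
  have hcf : IsCoreFocus S04CharAlgebra.pAlg (invInst (baseHike E) ed) (baseHike E) Echeck := hEc
  equiInvLocAt_iff_isRegular_sing A (invInst (baseHike E) ed) (baseHike E) hb hcf
    (isStandard_of_isCoreFocus_baseHike A (invInst (baseHike E) ed) E hE.1 hb hcf)
    (fun _ hξ => spanFinrank_maximalIdeal_eq_of_isCoreFocus A (invInst (baseHike E) ed) (baseHike E) ed hcf hξ) hR1 hex'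

end PerInstance

/-! ## §3 On the class: `EquiInvLocOn 𝒞` is ONE premise with 20a and with the regular residual -/
section Exact

variable {𝒞 : ∀ ⦃W : Scheme.{u}⦄, IdealExponent W → Set W → Prop}
  {IsEdgeData IsEdgeData' IsEdgeData'' : ∀ ⦃X : Scheme.{u}⦄ ⦃p n : ℕ⦄ (E : IdealExponent X) (ξ : X), EdgeDatumAt p n E ξ → Prop}
  {p : ℕ} [Fact p.Prime] {K : Type u} [Field K] [CharP K p] [PerfectField K] {A : AmbientDatum p K} {n : ℕ}

/-- **Regular residual ⇒ `EquiInvLocOn`** (read data in any provenance implying R1): p498576 `isRegular_sing_of_hatClosureRegularOn`, then §2. [folklore] -/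
theorem equiInvLocOn_of_hatClosureRegularOn
    (hR1 : ∀ (F : IdealExponent A.Z) (η : A.Z) (D : EdgeDatumAt p n F η), IsEdgeData' F η D → S04CharAlgebra.IsEdgeData D)
    (h : HatClosureRegularOn 𝒞 IsEdgeData A n) : EquiInvLocOn 𝒞 IsEdgeData IsEdgeData' A n :=
  fun E ed hE hb hed hC _ hEc =>
    equiInvLocAt_of_isRegular_sing A (invInst (baseHike E) ed) (baseHike E) hb hEc (hR1 _)
      (isRegular_sing_of_hatClosureRegularOn h E ed hE hb hed hC hEc)

/-- **«`Ě` exists with regular `Sing(Ě)`» on `𝒞` ⇒ `EquiInvLocOn 𝒞`** (p498576 `hatClosureRegularOn_of_coreFocusSingRegularOn`, then the previous). [folklore] -/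
theorem equiInvLocOn_of_coreFocusSingRegularOn
    (hR1 : ∀ (F : IdealExponent A.Z) (η : A.Z) (D : EdgeDatumAt p n F η), IsEdgeData' F η D → S04CharAlgebra.IsEdgeData D)
    (h : CoreFocusSingRegularOn 𝒞 IsEdgeData A n) : EquiInvLocOn 𝒞 IsEdgeData IsEdgeData' A n :=
  equiInvLocOn_of_hatClosureRegularOn hR1 (hatClosureRegularOn_of_coreFocusSingRegularOn h)

/-- **NECESSITY at every typed core focus, NO door, NO side condition**: `EquiInvLocOn 𝒞` (read data in a provenance admitting R1, `hex'`, with degree-one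
spanning, `hspan`) ⇒ every typed core focus of every realized member of `𝒞` has REGULAR `Sing(Ě)` (§2 `_inst` form over SEAT 2's p506263). [folklore] -/
theorem isRegular_sing_of_equiInvLocOn
    (hex' : ∀ (F : IdealExponent A.Z) (η : A.Z) (D : EdgeDatumAt p n F η), S04CharAlgebra.IsEdgeData D → IsEdgeData' F η D)
    (hspan : ∀ (F : IdealExponent A.Z) (η : A.Z) (D : EdgeDatumAt p n F η), IsEdgeData' F η D →
      ∀ b ∈ stalkIdeal (pAlg F 1) η, b ∈ maximalIdeal (A.Z.presheaf.stalk η) →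
        ∃ c : Fin D.r → A.Z.presheaf.stalk η, (∀ j, D.expo j ≠ 0 → c j = 0) ∧
          b - ∑ j, c j * D.g j ∈ maximalIdeal (A.Z.presheaf.stalk η) ^ 2)
    (h : EquiInvLocOn 𝒞 IsEdgeData IsEdgeData' A n)
    (E : IdealExponent A.Z) (ed : EdgeDataOn p n (baseHike E)) (hE : E.IsStandard) (hb : 0 < (baseHike E).b)
    (hed : IsEdgeDataOn IsEdgeData (baseHike E) ed)
    (hC : 𝒞 (baseHike E) (invmaxStratum ((baseHike E).sing ∩ S02Preliminaries.closedPoints A.Z) (invField (baseHike E) ed)))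
    {Echeck : IdealExponent A.Z} (hEc : IsCoreFocus_inst (baseHike E) Echeck ed) :
    Scheme.IsRegular (vanishingIdeal (⟨Echeck.sing, A.isClosed_sing Echeck⟩ : Closeds A.Z)).subscheme :=
  have hcf : IsCoreFocus S04CharAlgebra.pAlg (invInst (baseHike E) ed) (baseHike E) Echeck := hEc
  isRegular_sing_of_equiInvLocAt A (invInst (baseHike E) ed) (baseHike E) hb hcf
    (isStandard_of_isCoreFocus_baseHike A (invInst (baseHike E) ed) E hE.1 hb hcf)
    (fun _ hξ => spanFinrank_maximalIdeal_eq_of_isCoreFocus A (invInst (baseHike E) ed) (baseHike E) ed hcf hξ) (hex' Echeck)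
    (hspan Echeck) (h E ed hE hb hed hC Echeck hEc)

/-- **NECESSITY for the residual, given the door** (`CoreFocusExistsOn 𝒞`, p487786; PROVED on `LCIOrMonomialClass`, p494780). [folklore] -/
theorem hatClosureRegularOn_of_equiInvLocOn
    (hex' : ∀ (F : IdealExponent A.Z) (η : A.Z) (D : EdgeDatumAt p n F η), S04CharAlgebra.IsEdgeData D → IsEdgeData' F η D)
    (hspan : ∀ (F : IdealExponent A.Z) (η : A.Z) (D : EdgeDatumAt p n F η), IsEdgeData' F η D →
      ∀ b ∈ stalkIdeal (pAlg F 1) η, b ∈ maximalIdeal (A.Z.presheaf.stalk η) →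
        ∃ c : Fin D.r → A.Z.presheaf.stalk η, (∀ j, D.expo j ≠ 0 → c j = 0) ∧
          b - ∑ j, c j * D.g j ∈ maximalIdeal (A.Z.presheaf.stalk η) ^ 2)
    (hex : CoreFocusExistsOn 𝒞 IsEdgeData A n) (h : EquiInvLocOn 𝒞 IsEdgeData IsEdgeData' A n) :
    HatClosureRegularOn 𝒞 IsEdgeData A n := by
  intro E ed hE hb hed hC
  obtain ⟨Echeck, hEc⟩ := hex E ed hE hb hed hC
  exact (CampaignW31.invmaxClosureRegularOn_iff_isRegular_sing_of_isCoreFocus_inst A (baseHike E) ed hEc).mpr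
    (isRegular_sing_of_equiInvLocOn hex' hspan h E ed hE hb hed hC hEc)

/-- **20b(ii)-loc AND 20a ARE ONE PREMISE ON EVERY CLASS — NO door, NO side condition.** For every class `𝒞`, every input provenance `IsEdgeData`, every
read-provenance `IsEdgeData'` equivalent to R1 (`hR1`, `hex'`), and every reading `IsEdgeData''` of 20a's PRODUCED data implied by R1 ∧ R2 with degree-one
spanning (`hread`, `hspan`): `EquiInvLocOn 𝒞 IsEdgeData IsEdgeData' A n ↔ Thm614Part1On 𝒞 IsEdgeData IsEdgeData'' A n` — both are «for every typed core focus of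
every member» predicates EXACT to ⟨SingRegular(Ě)⟩ at the instance (§2; p493712 / p508013 `isRegular_sing_of_thm614Part1On'` for 20a). [folklore] -/
theorem equiInvLocOn_iff_thm614Part1On
    (hR1 : ∀ (F : IdealExponent A.Z) (η : A.Z) (D : EdgeDatumAt p n F η), IsEdgeData' F η D → S04CharAlgebra.IsEdgeData D)
    (hex' : ∀ (F : IdealExponent A.Z) (η : A.Z) (D : EdgeDatumAt p n F η), S04CharAlgebra.IsEdgeData D → IsEdgeData' F η D)
    (hread : ∀ (F : IdealExponent A.Z) (η : A.Z) (D : EdgeDatumAt p n F η),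
      S04CharAlgebra.IsEdgeData D → IsEdgeData_alg D → IsEdgeData'' F η D)
    (hspan : ∀ (F : IdealExponent A.Z) (η : A.Z) (D : EdgeDatumAt p n F η), IsEdgeData'' F η D →
      ∀ b ∈ stalkIdeal (pAlg F 1) η, b ∈ maximalIdeal (A.Z.presheaf.stalk η) →
        ∃ c : Fin D.r → A.Z.presheaf.stalk η, (∀ j, D.expo j ≠ 0 → c j = 0) ∧
          b - ∑ j, c j * D.g j ∈ maximalIdeal (A.Z.presheaf.stalk η) ^ 2) :
    EquiInvLocOn 𝒞 IsEdgeData IsEdgeData' A n ↔ Thm614Part1On 𝒞 IsEdgeData IsEdgeData'' A n :=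
  ⟨fun h E ed hE hb hed hC Echeck hEc =>
      Thm6_14_1_of_isRegular_sing A n IsEdgeData'' hread _ E Echeck hE hEc ed hEc
        (isRegular_sing_of_equiInvLocOn hex' (fun F η D hD => D.degOneSpan_of_isEdgeData (hR1 F η D hD)) h E ed hE hb hed hC hEc),
    fun h E ed hE hb hed hC Echeck hEc =>
      equiInvLocAt_of_isRegular_sing A (invInst (baseHike E) ed) (baseHike E) hb hEc (hR1 Echeck)
        (isRegular_sing_of_thm614Part1On' hspan h E ed hE hb hed hC hEc)⟩

/-- **`EquiInvLocOn 𝒞` IS EXACT ON THE CLASS — ⟨HatClosureRegular⟩ form** (p498576), for every class carrying the door (`hex`). [folklore] -/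
theorem equiInvLocOn_iff_hatClosureRegularOn (hex : CoreFocusExistsOn 𝒞 IsEdgeData A n)
    (hR1 : ∀ (F : IdealExponent A.Z) (η : A.Z) (D : EdgeDatumAt p n F η), IsEdgeData' F η D → S04CharAlgebra.IsEdgeData D)
    (hex' : ∀ (F : IdealExponent A.Z) (η : A.Z) (D : EdgeDatumAt p n F η), S04CharAlgebra.IsEdgeData D → IsEdgeData' F η D) :
    EquiInvLocOn 𝒞 IsEdgeData IsEdgeData' A n ↔ HatClosureRegularOn 𝒞 IsEdgeData A n :=
  ⟨hatClosureRegularOn_of_equiInvLocOn hex' (fun F η D hD => D.degOneSpan_of_isEdgeData (hR1 F η D hD)) hex,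
    equiInvLocOn_of_hatClosureRegularOn hR1⟩

/-- **`EquiInvLocOn 𝒞` IS EXACT ON THE CLASS — R20 form** («`Ě` exists with regular `Sing(Ě)`» on `𝒞`, p498576). [folklore] -/
theorem equiInvLocOn_iff_coreFocusSingRegularOn (hex : CoreFocusExistsOn 𝒞 IsEdgeData A n)
    (hR1 : ∀ (F : IdealExponent A.Z) (η : A.Z) (D : EdgeDatumAt p n F η), IsEdgeData' F η D → S04CharAlgebra.IsEdgeData D)
    (hex' : ∀ (F : IdealExponent A.Z) (η : A.Z) (D : EdgeDatumAt p n F η), S04CharAlgebra.IsEdgeData D → IsEdgeData' F η D) :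
    EquiInvLocOn 𝒞 IsEdgeData IsEdgeData' A n ↔ CoreFocusSingRegularOn 𝒞 IsEdgeData A n :=
  ⟨fun h E ed hE hb hed hC => by
      obtain ⟨Echeck, hEc⟩ := hex E ed hE hb hed hC
      exact ⟨Echeck, hEc, isRegular_sing_of_equiInvLocOn hex' (fun F η D hD => D.degOneSpan_of_isEdgeData (hR1 F η D hD)) h
        E ed hE hb hed hC hEc⟩,
    equiInvLocOn_of_coreFocusSingRegularOn hR1⟩

/-- **`EquiInvLocOn` HOLDS, binder-free, ON THE CLASS OF REGULAR TOP STRATA** (`RegularClosureClass`, p498576). [folklore] -/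
theorem equiInvLocOn_regularClosureClass
    (hR1 : ∀ (F : IdealExponent A.Z) (η : A.Z) (D : EdgeDatumAt p n F η), IsEdgeData' F η D → S04CharAlgebra.IsEdgeData D) :
    EquiInvLocOn RegularClosureClass IsEdgeData IsEdgeData' A n :=
  equiInvLocOn_of_hatClosureRegularOn hR1 hatClosureRegularOn_regularClosureClass

/-- **ONE MEMBER KILLS `EquiInvLocOn` ON THE CLASS, NO side condition**: a realized member `(E, ed)` of `𝒞` with a typed core focus whose `Sing(Ě)` is NOT
regular refutes `EquiInvLocOn 𝒞 IsEdgeData IsEdgeData'` for every read-provenance admitting R1 with degree-one spanning. [folklore] -/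
theorem not_equiInvLocOn_of_singular_member
    (hex' : ∀ (F : IdealExponent A.Z) (η : A.Z) (D : EdgeDatumAt p n F η), S04CharAlgebra.IsEdgeData D → IsEdgeData' F η D)
    (hspan : ∀ (F : IdealExponent A.Z) (η : A.Z) (D : EdgeDatumAt p n F η), IsEdgeData' F η D →
      ∀ b ∈ stalkIdeal (pAlg F 1) η, b ∈ maximalIdeal (A.Z.presheaf.stalk η) →
        ∃ c : Fin D.r → A.Z.presheaf.stalk η, (∀ j, D.expo j ≠ 0 → c j = 0) ∧
          b - ∑ j, c j * D.g j ∈ maximalIdeal (A.Z.presheaf.stalk η) ^ 2)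
    (E : IdealExponent A.Z) (ed : EdgeDataOn p n (baseHike E)) (hE : E.IsStandard) (hb : 0 < (baseHike E).b)
    (hed : IsEdgeDataOn IsEdgeData (baseHike E) ed)
    (hC : 𝒞 (baseHike E) (invmaxStratum ((baseHike E).sing ∩ S02Preliminaries.closedPoints A.Z) (invField (baseHike E) ed)))
    {Echeck : IdealExponent A.Z} (hEc : IsCoreFocus_inst (baseHike E) Echeck ed)
    (hsing : ¬ Scheme.IsRegular (vanishingIdeal (⟨Echeck.sing, A.isClosed_sing Echeck⟩ : Closeds A.Z)).subscheme) :
    ¬ EquiInvLocOn 𝒞 IsEdgeData IsEdgeData' A n := fun h =>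
  hsing (isRegular_sing_of_equiInvLocOn hex' hspan h E ed hE hb hed hC hEc)

end Exact

end CampaignW36

open CampaignW36

/-! ## §4 Binder-free `p`-slices -/
/-- **[OURS · L1 W3.6 ↔ R20 20b(ii)] `CampaignW36EquiInvLocOnI 𝒞 p`** — `p`-slice of «on the class `𝒞`, at every typed core focus, `Inv_·(Ě)` read off any Def. 4.9
datum is LOCALLY CONSTANT on `Sing(Ě)_cl`» at `CampaignW31.edgeDataProvenance` (row 005 b's `IsEdgeData`, input family AND read data). Replaces the role of
Eq. (125) p.78 l.33–37 on the class; CANDIDATE beyond regular top strata; NOT a statement of the manuscript; ⟺ BOTH `p`-slices of 20a on `𝒞`. [folklore] -/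
def CampaignW36EquiInvLocOnI (𝒞 : ∀ ⦃W : Scheme.{u}⦄, IdealExponent W → Set W → Prop) (p : ℕ) [Fact p.Prime] : Prop :=
  ∀ (K : Type u) [Field K] [CharP K p] [PerfectField K] (A : AmbientDatum p K) (n : ℕ),
    EquiInvLocOn 𝒞 CampaignW31.edgeDataProvenance CampaignW31.edgeDataProvenance A n

/-- **20b(ii)-loc|`𝒞` ⟺ 20a|`𝒞` BY NAME, UNCONDITIONALLY, ON EVERY CLASS `𝒞` AND FOR EVERY PRIME `p`** — in BOTH readings (R1 `CampaignW36Thm614Part1OnI`, R2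
`CampaignW36Thm614Part1OnR2I`, p501108) of 20a's produced data; no door, no side condition. NOT a statement of the manuscript. [folklore] -/
theorem campaignW36EquiInvLocOnI_iff_thm614Part1OnI (𝒞 : ∀ ⦃W : Scheme.{u}⦄, IdealExponent W → Set W → Prop) (p : ℕ) [Fact p.Prime] :
    (CampaignW36EquiInvLocOnI.{u} 𝒞 p ↔ CampaignW36Thm614Part1OnI.{u} 𝒞 p) ∧
      (CampaignW36EquiInvLocOnI.{u} 𝒞 p ↔ CampaignW36Thm614Part1OnR2I.{u} 𝒞 p) :=
  ⟨⟨fun h K _ _ _ A n => (equiInvLocOn_iff_thm614Part1On (fun _ _ _ h' => h') (fun _ _ _ h' => h') (fun _ _ _ h' _ => h')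
      (fun _ _ D hD => D.degOneSpan_of_isEdgeData hD)).mp (h K A n),
    fun h K _ _ _ A n => (equiInvLocOn_iff_thm614Part1On (fun _ _ _ h' => h') (fun _ _ _ h' => h') (fun _ _ _ h' _ => h')
      (fun _ _ D hD => D.degOneSpan_of_isEdgeData hD)).mpr (h K A n)⟩,
   ⟨fun h K _ _ _ A n => (equiInvLocOn_iff_thm614Part1On (fun _ _ _ h' => h') (fun _ _ _ h' => h') (fun _ _ _ _ h' => h')
      (fun _ _ D hD => D.degOneSpan_of_isEdgeData_alg hD)).mp (h K A n),
    fun h K _ _ _ A n => (equiInvLocOn_iff_thm614Part1On (fun _ _ _ h' => h') (fun _ _ _ h' => h') (fun _ _ _ _ h' => h')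
      (fun _ _ D hD => D.degOneSpan_of_isEdgeData_alg hD)).mpr (h K A n)⟩⟩

/-- **EXACT, `p`-slices, for every class carrying the door** (`CampaignW36CoreFocusExistsOnI 𝒞 p`, p487786): `CampaignW36EquiInvLocOnI 𝒞 p` ⟺ «`Ě` exists with
regular `Sing(Ě)`» on `𝒞` ⟺ ⟨HatClosureRegular⟩ on `𝒞` (p498576). NOT a statement of the manuscript. [folklore] -/
theorem campaignW36EquiInvLocOnI_iff_of_door (𝒞 : ∀ ⦃W : Scheme.{u}⦄, IdealExponent W → Set W → Prop) (p : ℕ) [Fact p.Prime]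
    (hdoor : CampaignW36CoreFocusExistsOnI.{u} 𝒞 p) :
    (CampaignW36EquiInvLocOnI.{u} 𝒞 p ↔ CampaignW36CoreFocusSingRegularOnI.{u} 𝒞 p) ∧
      (CampaignW36EquiInvLocOnI.{u} 𝒞 p ↔ CampaignW36HatClosureRegularOnI.{u} 𝒞 p) :=
  ⟨⟨fun h K _ _ _ A n => (equiInvLocOn_iff_coreFocusSingRegularOn (hdoor K A n) (fun _ _ _ h' => h') (fun _ _ _ h' => h')).mp (h K A n),
    fun h K _ _ _ A n => equiInvLocOn_of_coreFocusSingRegularOn (fun _ _ _ h' => h') (h K A n)⟩,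
   ⟨fun h K _ _ _ A n => (equiInvLocOn_iff_hatClosureRegularOn (hdoor K A n) (fun _ _ _ h' => h') (fun _ _ _ h' => h')).mp (h K A n),
    fun h K _ _ _ A n => equiInvLocOn_of_hatClosureRegularOn (fun _ _ _ h' => h') (h K A n)⟩⟩

/-- **UNCONDITIONAL on every sub-class of the door's class** (`𝒞 ≤ LCIOrMonomialClass`, door p494780): `CampaignW36EquiInvLocOnI 𝒞 p` ⟺
`CampaignW36CoreFocusSingRegularOnI 𝒞 p` ⟺ `CampaignW36HatClosureRegularOnI 𝒞 p`, NO side condition. NOT a statement of the manuscript. [folklore] -/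
theorem campaignW36EquiInvLocOnI_iff_of_le_lciOrMonomial (𝒞 : ∀ ⦃W : Scheme.{u}⦄, IdealExponent W → Set W → Prop) (p : ℕ)
    [Fact p.Prime] (hlm : ∀ ⦃W⦄ (F : IdealExponent W) (S : Set W), 𝒞 F S → LCIOrMonomialClass F S) :
    (CampaignW36EquiInvLocOnI.{u} 𝒞 p ↔ CampaignW36CoreFocusSingRegularOnI.{u} 𝒞 p) ∧
      (CampaignW36EquiInvLocOnI.{u} 𝒞 p ↔ CampaignW36HatClosureRegularOnI.{u} 𝒞 p) :=
  campaignW36EquiInvLocOnI_iff_of_door 𝒞 p fun K _ _ _ A n =>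
    coreFocusExistsOn_mono hlm (campaignW36CoreFocusExists_lciOrMonomial_holds p K A n)

/-- **[OURS · L1 W3.1, UNCONDITIONAL] `CampaignW36EquiInvLocOnI RegularClosureClass p`** holds for every prime `p`. NOT a statement of the manuscript. [folklore] -/
theorem campaignW36EquiInvLocOnI_regularClosure_holds (p : ℕ) [Fact p.Prime] :
    CampaignW36EquiInvLocOnI.{u} RegularClosureClass p :=
  fun _ _ _ _ _ _ => equiInvLocOn_regularClosureClass fun _ _ _ h => h

/-- **ONE MEMBER KILLS THE `p`-SLICE ON ITS CLASS, NO side condition**: a realized member of `𝒞` over SOME perfect field of characteristic `p` with a typed core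
focus whose `Sing(Ě)` is NOT regular gives `¬ CampaignW36EquiInvLocOnI 𝒞 p`. NOT a statement of the manuscript. [folklore] -/
theorem not_campaignW36EquiInvLocOnI_of_singular_member (𝒞 : ∀ ⦃W : Scheme.{u}⦄, IdealExponent W → Set W → Prop) (p : ℕ)
    [Fact p.Prime] (K : Type u) [Field K] [CharP K p] [PerfectField K] (A : AmbientDatum p K) (n : ℕ) (E : IdealExponent A.Z)
    (ed : EdgeDataOn p n (baseHike E)) (hE : E.IsStandard) (hb : 0 < (baseHike E).b)
    (hed : IsEdgeDataOn CampaignW31.edgeDataProvenance (baseHike E) ed)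
    (hC : 𝒞 (baseHike E) (invmaxStratum ((baseHike E).sing ∩ S02Preliminaries.closedPoints A.Z) (invField (baseHike E) ed)))
    {Echeck : IdealExponent A.Z} (hEc : IsCoreFocus_inst (baseHike E) Echeck ed)
    (hsing : ¬ Scheme.IsRegular (vanishingIdeal (⟨Echeck.sing, A.isClosed_sing Echeck⟩ : Closeds A.Z)).subscheme) :
    ¬ CampaignW36EquiInvLocOnI.{u} 𝒞 p := fun h =>
  not_equiInvLocOn_of_singular_member (fun _ _ _ h' => h') (fun _ _ D hD => D.degOneSpan_of_isEdgeData hD) E ed hE hb hed hC hEc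
    hsing (h K A n)

/-- **THE CARRIER WITHOUT NAMING `Ě`**: a realized member of `𝒞` inside the door's class `LCIOrMonomialClass` whose `Σ̄_max(Ê)` is NOT regular kills
`CampaignW36EquiInvLocOnI 𝒞 p` (door p494780; `Σ̄_max(Ê) = Sing(Ě)`, p498576 §1); SEAT 1's shape is `𝒞 := LCIClass`, `hlm := lciClass_le _ _ hC` (no member
certified IN THIS FILE). NOT a statement of the manuscript. [folklore] -/
theorem not_campaignW36EquiInvLocOnI_of_singular_closure (𝒞 : ∀ ⦃W : Scheme.{u}⦄, IdealExponent W → Set W → Prop) (p : ℕ)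
    [Fact p.Prime] (K : Type u) [Field K] [CharP K p] [PerfectField K] (A : AmbientDatum p K) (n : ℕ) (E : IdealExponent A.Z)
    (ed : EdgeDataOn p n (baseHike E)) (hE : E.IsStandard) (hb : 0 < (baseHike E).b)
    (hed : IsEdgeDataOn CampaignW31.edgeDataProvenance (baseHike E) ed)
    (hC : 𝒞 (baseHike E) (invmaxStratum ((baseHike E).sing ∩ S02Preliminaries.closedPoints A.Z) (invField (baseHike E) ed)))
    (hlm : LCIOrMonomialClass (baseHike E)
      (invmaxStratum ((baseHike E).sing ∩ S02Preliminaries.closedPoints A.Z) (invField (baseHike E) ed)))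
    (hsing : ¬ CampaignW31.InvmaxClosureRegularOn ((baseHike E).sing ∩ S02Preliminaries.closedPoints A.Z)
      (invField (baseHike E) ed)) :
    ¬ CampaignW36EquiInvLocOnI.{u} 𝒞 p := by
  obtain ⟨Echeck, hEc⟩ := campaignW36CoreFocusExists_lciOrMonomial_holds p K A n E ed hE hb hed hlm
  exact not_campaignW36EquiInvLocOnI_of_singular_member 𝒞 p K A n E ed hE hb hed hC hEc fun hreg =>
    hsing ((CampaignW31.invmaxClosureRegularOn_iff_isRegular_sing_of_isCoreFocus_inst A (baseHike E) ed hEc).mpr hreg)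

end Summit.ResolutionOfSingularities.ResolutionOfSingularities.Theorems

end
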